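import Summits.QuantumFields.BalabanUV.T4Continuum.Support.NE7HintOfUhlenbeckChartSU2DecSlice
import Summits.QuantumFields.BalabanUV.T4Continuum.Support.NE7PairResidualSupRep
import Summits.QuantumFields.BalabanUV.T4Continuum.Support.AveragingDeficitMultiLevelBridge
import HarnessLib

/-!
# GEN 99 RE-THREAD (`…Slice`, Bałaban-slice road, memo `t4/b2b-balaban-t4-ne7-p1-g99/ROAD-G99.md` §3.5 ∕ §3.8): this file is `NE7HintOfSliceNormalisationSU2Dec`'s CHAIN THEOREM VERBATIM except that
# the slice `T_♮(U♯) = frameFreeBlockLandauW` of the per-pair binder is replaced by an ABSTRACT SLICE FAMILY `𝒯 k U♯` with the two hypotheses (hT) «tangent-critical ⟹ critical on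
# `𝒯 j W`» and (hP) «class SlicePoincare for `𝒯 j W`» in the generic theorems, and by the corner-free energy block-Landau slice `𝒯_E = energyBlockLandauW` (both hypotheses
# DISCHARGED: `hT_energyBlockLandau`, `classSlicePoincare_energyBlockLandau_SU2`, constant `8·CPLine 4 2 2 10⁻¹⁷ 10⁻⁵³ + 1`) in the SU(2) `d = 4` `L = 2` theorems; chain predecessors are
# the `…Slice` ∕ `…GenericSlice` re-issues (lineage `b2b-balaban-t4-ne7-p1` gen 99, CRUX PROVER NE7 #1).  NOT NE7; spine 0∕9.  Original docstring follows.

# GEN 95 END OF RECORD (`…Dec`): F324 RE-ISSUED OVER THE HONEST PER-PAIR BINDER — `hint_SU2_of_decomposition`: (8)∃ ⇐ ONE k-free line ∧ `hdecomp♭`, where `hdecomp♭` asks,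
# for every admissible pair with gen 94's residual near-representative `u₀` SUPPLIED, a unitary gauge `u` and a decomposition `U′^{u} = U_s·e^{X}`, `X = X_T + X_N`, `X_T ∈ T_♮(U_s)`,
# with `‖X_N‖_w ≤ ν‖X‖_w`, `(ε∕M²)Σ‖curl X_N‖ ≤ κ‖X‖_w²`, `sup‖X‖·M ≤ α̂`, `ν ≤ ν̂`, `κ ≤ κ̂` (the weight currency of `hleaves♭` — numerically refuted for arbitrary pairs, memo
# `t4/b2b-balaban-t4-ne7-p1-g95/WEIGHT-CURRENCY-DEAD.md` — is GONE; suppliers: F326 `decomp_of_directLetters` or any approximate slice fixing).  Original docstring follows.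

# Support | NE7 END OF RECORD over `NE7HintOfUhlenbeckChartSU2.hint_SU2` (F324): THE SUP HALF OF ROW NE3's PER-PAIR BINDER DISCHARGED — `hleaves` is replaced
# by `hleaves♭`, the SLICE NORMALISATION of a GIVEN residual near-representative (the near-representative itself is now a theorem:
# `NE7PairResidualSupRep.pair_residual_sup_rep`, gen 94)

Informal class name: ROW NE7's HINT THEOREM WITH THE PAIR'S RELATIVE SUP DATUM SUPPLIED.

`NE7HintOfUhlenbeckChartSU2.hint_SU2` (gen 93's END of the NE7 record) takes, besides the two numeric lines, ROW NE3's per-pair binder `hleaves`: for every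
tangent-critical admissible `U_s` and every admissible `U′` over the same datum, a RESIDUAL SLICE REPRESENTATIVE (`ResidualSliceRepT`: a unitary periodic
corner-trivial gauge `u`, `U′^{u} = U_s·e^{X₀}` with `X₀` in the slice `T_♮(U_s)`, `‖X₀‖ ≤ α₀`) with the weight∕currencies (`α₀M ≤ α̂`, `mM ≤ α̂`, `C ≤ Ĉ`, the local
quadratic letter).  Gen 94 proves the SUP HALF of this binder for ARBITRARY pairs: `pair_residual_sup_rep` — two unitary `(N·M)`-periodic configurations with plaquettes
`ε∕M²`-close to `1` and the same `(k+1)`-fold average have a unitary `(N·M)`-periodic corner-trivial gauge `u₀` with `‖U_s(b)⁻¹U′^{u₀}(b) − 1‖ ≤ 10³⁴ε∕M` on every bond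
([Balaban1985RegularSpaces] Lemma 1 ∕ Thm 2 (1.36)₁ TYPE at a pair; OUR road: cube Landau charts of gen 93's engine, corner consistency from the iterated-average segment
letter, two-party geodesic gluing over the 16 block parities, four period halvings — files F315–F323b).  THIS FILE's END therefore asks only for `hleaves♭`: the SAME
conclusion as `hleaves`, but from the ADDITIONAL premise of such a near-representative `u₀` — i.e. the slice normalisation (the exact `T_♮(U_s)` condition by a small
residual gauge correction, [Balaban1985RegularSpaces] Sects. D–E TYPE) and the currencies; `ε₀` shrinks to `≤ 1∕(2·10²¹)` so that `pair_residual_sup_rep`'s regime holds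
at `card n = 2`.

HONEST LABEL: finite T⁴ rung (B)+1 — NOT infinite volume, NOT mass gap, NOT `BetaPertH`, NOT Clay.  `hleaves♭` and the numeric lines are HYPOTHESES asserted for nothing;
nothing of Bałaban's asserted; NE7 NOT PROVED; spine 0∕9.  No `sorry`; axioms ⊆ {propext, Classical.choice, Quot.sound}.

Worked on by: prover-b2b-balaban-t4-ne7-p1-g94-0 (lineage b2b-balaban-t4-ne7-p1, gen 94: F324, the END over F314b).
-/

open scoped BigOperators Matrix Matrix.Norms.L2Operator Topology
open NormedSpace Finset Set Filter

namespace Summit.QuantumFields.BalabanUV.T4Continuum.NE7HintOfSliceNormalisationSU2DecSlice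

open Literature.MathematicalPhysics.QuantumFieldTheory.Balaban1983to89
open B7Prop1Explicit B7Prop2Explicit MatrixLog UnitaryModel MatrixNorms
open T4AveragingDeficitWall (Ad IsUnitaryCfg IsSkewDir SmallField vary curl curlSq dirSq dirL1)
open T4AveragingDeficitWallBoundary (IsPeriodicCfg periodBox)
open AveragingDeficitPeriodicCounting (IsPeriodicDir)
open AveragingDeficitMultiLevelPrep (LevelSmall tower TangentIter cavgIter)
open AveragingDeficitMultiLevelBridge (cavgIter_eq_avgIter)
open BlockAverageVaryHolo (nbRad)
open MinimalActionLevels (perWin)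
open MinimalActionSandwich (IsMinimiser admissible)
open MinimalActionRate (sfClass)
open NE3HessForm (dAction)
open NE3SlicePoincareBudgetLine (CPLine)
open NE3TangentCovariantTower (dirIter)
open NE3DecomposedRepOfLinearNormalPart (ResidualSliceRepT)
open NE3QbarIterCovLiftPrep (cruxC)
open NE3SmoothRightInverseW (rightInvW)
open NE3RightInverseSolveLetters (thetaLoc)
open NE3RightInverseL2Letter (l2C)
open NE3HatInvCurlLetters (curl2C curl1C)
open NE3EnergyShapes (IsUnitarySite IsPeriodicSite)
open NE7HintOfUhlenbeckChartSU2DecSlice (hint_SU2)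
open NE3EnergyWeightedShapes (energyNormW)
open NE7MeanZeroGaugeSliceW (energyBlockLandauW)
open NE7EnergyBlockLandauClassPoincare (classSlicePoincare_energyBlockLandau_SU2)
open NE7ConvOneStepGenericSlice (hT_energyBlockLandau)
open NE7PairResidualSupRep (pair_residual_sup_rep)

variable {n : Type} [Fintype n] [DecidableEq n]

/-- **ROW NE7's END OF RECORD OVER THE HONEST BINDER, THE PAIR'S RELATIVE SUP DATUM SUPPLIED** (gen 95: `hleaves♭` ↦ `hdecomp♭`; original description follows): gen 93's `hint_SU2` with ROW NE3's per-pair binder `hleaves` replaced by `hleaves♭` — the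
same slice representative and currencies, but FROM a given residual near-representative `u₀` (unitary, `(N·M)`-periodic, corner-trivial, `‖U_s(b)⁻¹U′^{u₀}(b) − 1‖ ≤
10³⁴ε∕M`), which `NE7PairResidualSupRep.pair_residual_sup_rep` supplies for every admissible pair. [folklore] -/
theorem hint_SU2_of_decomposition [Nonempty n] (hn : Fintype.card n = 2) :
    ∃ ℓ : ℕ, 1 ≤ ℓ ∧ ∃ ε₀ : ℝ, 0 < ε₀ ∧ ∀ ε : ℝ, 0 < ε → ε ≤ ε₀ → ∃ β₀ : ℝ, 0 < β₀ ∧ ∀ β : ℝ, 0 < β → β ≤ β₀ →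
    ∀ (N : ℕ) [NeZero N] (αh νh κh : ℝ), 1 ≤ N →
    -- the k-free ceilings `(α̂, ν̂, κ̂)` of the honest per-pair binder and ONE k-free strict line (F327)
    2 * κh < ((((1 / 2 - νh ^ 2) / (2 * (1 + (8 * CPLine 4 2 2 (1 / 10 ^ 17) (1 / 10 ^ 53) + 1))) - νh ^ 2) / 2 - 576 * ((4 : ℕ) : ℝ) * (αh ^ 2 * Real.exp (2 * αh))) / (Fintype.card n : ℝ) - 28 * ((4 : ℕ) : ℝ) * (ε + 7 * αh ^ 2)) →
    -- THE HONEST PER-PAIR BINDER WITH THE SUP HALF SUPPLIED (`hdecomp♭`: the decomposition + energy letters of a residual near-representative)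
    (∀ D : Site 4 → Fin 4 → (Matrix n n ℂ)ˣ, IsUnitaryCfg D → IsPeriodicCfg D (N : ℤ) → SmallField D (4 * (Real.exp β - 1)) → ∀ (k : ℕ), ∀ Us ∈ admissible (sfClass 4 2 N ε) 2 (k + 1) D, SmallField Us ((1 / ((2 : ℕ) : ℝ) ^ 2 * ε / 2) / (((2 : ℕ) : ℝ) ^ (k + 1)) ^ 2) → (∀ φ : Site 4 → Fin 4 → Matrix n n ℂ, IsSkewDir φ → IsPeriodicDir φ ((N * 2 ^ (k + 1) : ℕ) : ℤ) → TangentIter 2 k Us φ → dAction Us φ (perWin 4 (N * 2 ^ (k + 1))) = 0) → ∀ U' ∈ admissible (sfClass 4 2 N ε) 2 (k + 1) D,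
      -- NEW (gen 94): GIVEN ANY RESIDUAL NEAR-REPRESENTATIVE — a unitary `(N·M)`-periodic corner-trivial gauge in which `U′` is `10³⁴·ε∕M`-close to `U_s` bondwise
      ∀ u₀ : Site 4 → (Matrix n n ℂ)ˣ, IsUnitarySite u₀ → IsPeriodicSite u₀ ((N * 2 ^ (k + 1) : ℕ) : ℤ) → (∀ z : Site 4, u₀ (((2 ^ (k + 1) : ℕ) : ℤ) • z) = 1) →
        (∀ (x : Site 4) (μ : Fin 4), ‖(((Us x μ)⁻¹ * gaugeAct u₀ U' x μ : (Matrix n n ℂ)ˣ) : Matrix n n ℂ) - 1‖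
          ≤ 10000000000000000000000000000000000 * (2 : ℝ) ^ (k + 1) * (ε / (((2 : ℕ) : ℝ) ^ (k + 1)) ^ 2)) →
      ∃ (u : Site 4 → (Matrix n n ℂ)ˣ) (X XT XN : Site 4 → Fin 4 → Matrix n n ℂ) (α ν κ : ℝ),
        IsUnitarySite u ∧ IsSkewDir X ∧ IsPeriodicDir X ((N * 2 ^ (k + 1) : ℕ) : ℤ) ∧ 0 ≤ α ∧ (∀ x μ, ‖X x μ‖ ≤ α) ∧
        gaugeAct u U' = vary Us X 1 ∧
        X = XT + XN ∧ XT ∈ energyBlockLandauW (d := 4) (n := n) 2 N (k + 1) Us ∧ IsSkewDir XN ∧ 0 ≤ ν ∧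
        energyNormW 2 (k + 1) Us XN (periodBox (d := 4) (N * 2 ^ (k + 1)))
          ≤ ν * energyNormW 2 (k + 1) Us X (periodBox (d := 4) (N * 2 ^ (k + 1))) ∧
        ε / (((2 : ℕ) : ℝ) ^ (k + 1)) ^ 2 * (∑ p ∈ perWin 4 (N * 2 ^ (k + 1)), ‖curl Us XN p‖)
          ≤ κ * energyNormW 2 (k + 1) Us X (periodBox (d := 4) (N * 2 ^ (k + 1))) ^ 2 ∧
        α * ((2 : ℕ) : ℝ) ^ (k + 1) ≤ αh ∧ ν ≤ νh ∧ κ ≤ κh) →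
    ∃ δV : ℝ, 0 < δV ∧
      ∀ V ∈ {V : Site 4 → Fin 4 → (Matrix n n ℂ)ˣ | IsUnitaryCfg V ∧ IsPeriodicCfg V (N : ℤ) ∧ SmallField V δV},
      ∀ k : ℕ, ∃ U : Site 4 → Fin 4 → (Matrix n n ℂ)ˣ, IsMinimiser 4 (sfClass 4 2 N ε) 2 N k V U ∧
        ∃ a : ℝ, 0 ≤ a ∧ a < ε / (((2 : ℕ) : ℝ) ^ k) ^ 2 ∧ SmallField U a := by

  obtain ⟨ℓ, hℓ1, ε₀, hε₀, H⟩ := hint_SU2 (n := n) hn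
  refine ⟨ℓ, hℓ1, min ε₀ (1 / 2000000000000000000000), lt_min hε₀ (by norm_num), fun ε hε hεle => ?_⟩
  obtain ⟨β₀, hβ₀, H2⟩ := H ε hε (hεle.trans (min_le_left _ _))
  refine ⟨β₀, hβ₀, fun β hβ hβle N _ αh νh κh hN hline hdecomp => ?_⟩
  have hε21 : ε ≤ 1 / 2000000000000000000000 := hεle.trans (min_le_right _ _)
  refine H2 β hβ hβle N αh νh κh hN hline ?_
  intro D hD hDP hDS k Us hUs hUsS hcrit U' hU'
  -- the pair's relative sup datum from `pair_residual_sup_rep`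
  have hUs' : IsUnitaryCfg Us ∧ IsPeriodicCfg Us ((N * 2 ^ (k + 1) : ℕ) : ℤ) ∧ SmallField Us (ε / (((2 : ℕ) : ℝ) ^ (k + 1)) ^ 2) := hUs.1
  have hU'' : IsUnitaryCfg U' ∧ IsPeriodicCfg U' ((N * 2 ^ (k + 1) : ℕ) : ℤ) ∧ SmallField U' (ε / (((2 : ℕ) : ℝ) ^ (k + 1)) ^ 2) := hU'.1
  have htop : cavgIter 2 (k + 1) U' = cavgIter 2 (k + 1) Us := by
    rw [cavgIter_eq_avgIter, cavgIter_eq_avgIter, hU'.2, hUs.2]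
  have hη : 0 < ε / (((2 : ℕ) : ℝ) ^ (k + 1)) ^ 2 := by positivity
  have hθ : 1000000000000000000000 * (Fintype.card n : ℝ) * (((2 : ℝ) ^ (k + 1)) ^ 2 * (ε / (((2 : ℕ) : ℝ) ^ (k + 1)) ^ 2)) ≤ 1 := by
    have hM0 : (0 : ℝ) < ((2 : ℕ) : ℝ) ^ (k + 1) := by positivity
    have hid : ((2 : ℝ) ^ (k + 1)) ^ 2 * (ε / (((2 : ℕ) : ℝ) ^ (k + 1)) ^ 2) = ε := by
      push_cast at hM0 ⊢; field_simp
    rw [hid, hn]; push_cast; linarith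
  obtain ⟨u₀, hu₀U, hu₀P, hu₀pin, hu₀err⟩ :=
    pair_residual_sup_rep hU''.1 hUs'.1 hN hU''.2.1 hUs'.2.1 hη hU''.2.2 hUs'.2.2 htop hθ
  exact hdecomp D hD hDP hDS k Us hUs hUsS hcrit U' hU' u₀ hu₀U hu₀P hu₀pin hu₀err

end Summit.QuantumFields.BalabanUV.T4Continuum.NE7HintOfSliceNormalisationSU2DecSlice
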